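import Summits.Ventures.WeilGRH.UniformConductorFloorMinorant
import Summits.Ventures.WeilGRH.UniformConductorFloorLorentzBudget
import HarnessLib

/-!
# GRH arm (rh-explicit, venture WeilGRH): the archimedean gain with `M` Lévy layers and the corresponding floor theorem

Cell `rh-explicit`, WEIL TRACK — GRH ARM (weil-grh-1).  `UniformConductorFloorLorentzBudget.lean` keeps ONE term of the
vertical series of `Re ψ` (gain `e^{−2xt}/x`).  Keeping `M` terms and bounding each Lorentzian deficit in position space
(`layer_eq_integral`, `lorentz_deficit_le`: layer `m` contributes at least `e^{−2(m+x)t}/(m+x)`) gives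

* `UniformFloor.arch_lower_bound_layers`: `(ψ(x) + Σ_{m<M} e^{−2(m+x)t}/(m+x))‖g‖₂² ≤ (1/2π)∫|ĝ(1/2+iτ)|² Re ψ(x+iτ/2) dτ`;
* `UniformFloor.weilPositivityOnChar_of_phi_budget_layers`: for `χ` mod `q ≠ 1` of parity `κ`, a `φ`-certificate `ρ` for the
  primes and any `γ ≤ Σ_{m<M} e^{−2(m+x)t}/(m+x)`: `log π − ψ(x) − γ + ρ ≤ log q ⇒ WeilPositivityOnChar χ t`.

(Used with the `J = 80` cell certificate at `t = 1`: `UniformConductorFloorCellsEighty*.lean`, floors `144` / odd `56`.)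

## References

* A. Weil (1952), (11) with (5), (10) and the «lemme» p. 262 [Weil1952FormulesExplicites]; H. Yoshida (1992) §2, §6 [Yoshida1992].
-/

noncomputable section

open Complex Filter Set MeasureTheory
open scoped Real Topology ComplexConjugate ArithmeticFunction.vonMangoldt

namespace Summit.Ventures.WeilGRH

open Literature.NumberTheory.LFunctions

namespace UniformFloor

variable {g : ℝ → ℂ}

/-- **ARCHIMEDEAN LOWER BOUND WITH `M` LAYERS**: for a test function `g` supported in `[-t, t]`, `x > 0`, `M ∈ ℕ`,
`(ψ(x) + Σ_{m<M} e^{−2(m+x)t}/(m+x))·‖g‖₂² ≤ (1/2π)∫|ĝ(1/2+iτ)|² Re ψ(x + iτ/2) dτ`. [folklore] -/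
theorem arch_lower_bound_layers (hg : IsWeilTest g) {t : ℝ} (hsupp : tsupport g ⊆ Icc (-t) t)
    {x : ℝ} (hx : 0 < x) (M : ℕ) :
    ((digamma (x : ℂ)).re + ∑ m ∈ Finset.range M, Real.exp (-(2 * ((m : ℝ) + x) * t)) / ((m : ℝ) + x)) *
        weilNorm2Sq g ≤
      1 / (2 * π) * ∫ τ : ℝ, ‖weilMellin g (1 / 2 + τ * I)‖ ^ 2 *
        (digamma ((x : ℂ) + ((τ / 2 : ℝ) : ℂ) * I)).re := by
  set N2 := weilNorm2Sq g with hN2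
  set k := weilConv g (weilReflect g) with hk
  set W : ℝ → ℝ := fun τ ↦ ‖weilMellin g (1 / 2 + τ * I)‖ ^ 2 with hW
  set A : ℝ := ∫ τ : ℝ, W τ * (digamma ((x : ℂ) + ((τ / 2 : ℝ) : ℂ) * I)).re with hA
  have hN20 : 0 ≤ N2 := integral_nonneg fun _ ↦ by positivity
  -- pointwise minorant of the weight
  have hpt : ∀ τ : ℝ, W τ * ((digamma (x : ℂ)).re) + ∑ m ∈ Finset.range M,
      W τ * (1 / ((m : ℝ) + x) - ((m : ℝ) + x) / (((m : ℝ) + x) ^ 2 + (τ / 2) ^ 2)) ≤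
      W τ * (digamma ((x : ℂ) + ((τ / 2 : ℝ) : ℂ) * I)).re := by
    intro τ
    have h := re_digamma_ge_sum x hx M τ
    have hW0 : 0 ≤ W τ := by positivity
    rw [← Finset.mul_sum, ← mul_add]
    exact mul_le_mul_of_nonneg_left h hW0
  have hIW : Integrable W := integrable_norm_sq_weilMellin_half_line hg
  have hIψ : Integrable fun τ : ℝ ↦ W τ * (digamma ((x : ℂ) + ((τ / 2 : ℝ) : ℂ) * I)).re := by
    refine (integrable_norm_sq_weilMellin_mul_re_digamma hg hx).congr (Eventually.of_forall fun τ ↦ ?_)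
    simp only [hW]
    congr 3
    push_cast
    ring
  have hIm : ∀ m : ℕ, Integrable fun τ : ℝ ↦
      W τ * (1 / ((m : ℝ) + x) - ((m : ℝ) + x) / (((m : ℝ) + x) ^ 2 + (τ / 2) ^ 2)) := by
    intro m
    have hl : 0 < (m : ℝ) + x := by positivity
    have h1 : Integrable fun τ : ℝ ↦ W τ * (((m : ℝ) + x) / (((m : ℝ) + x) ^ 2 + (τ / 2) ^ 2)) :=
      integrable_norm_sq_weilMellin_mul hg (continuous_lorentz hl).measurable (A := 1 / ((m : ℝ) + x)) (B := 0)
        (by positivity) le_rfl fun τ ↦ by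
          rw [abs_of_nonneg (lorentz_nonneg hl τ), zero_mul, add_zero]
          exact lorentz_le hl τ
    refine ((hIW.mul_const (1 / ((m : ℝ) + x))).sub h1).congr (Eventually.of_forall fun τ ↦ ?_)
    simp only [Pi.sub_apply]
    ring
  have hint := integral_mono
    (f := fun τ : ℝ ↦ W τ * ((digamma (x : ℂ)).re) + ∑ m ∈ Finset.range M,
      W τ * (1 / ((m : ℝ) + x) - ((m : ℝ) + x) / (((m : ℝ) + x) ^ 2 + (τ / 2) ^ 2)))
    ((hIW.mul_const _).add (integrable_finsetSum _ fun m _ ↦ hIm m)) hIψ hpt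
  rw [integral_add (hIW.mul_const _) (integrable_finsetSum _ fun m _ ↦ hIm m), integral_mul_const,
    integral_finsetSum _ (fun m _ ↦ hIm m), integral_norm_sq_weilMellin_half_line hg] at hint
  -- each layer: `(1/2π)∫W(1/l − L_l) = ∫ e_l (N2 − Re k) ≥ e^{−2lt}/l · N2`
  have hπ : 0 < 2 * π := by positivity
  have hlayer : ∀ m ∈ Finset.range M,
      2 * π * (Real.exp (-(2 * ((m : ℝ) + x) * t)) / ((m : ℝ) + x) * N2) ≤
        ∫ τ : ℝ, W τ * (1 / ((m : ℝ) + x) - ((m : ℝ) + x) / (((m : ℝ) + x) ^ 2 + (τ / 2) ^ 2)) := by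
    intro m _
    have hl : 0 < (m : ℝ) + x := by positivity
    have h1 := layer_eq_integral hg hl
    rw [← hN2, ← hk] at h1
    have hD := lorentz_deficit_le hg hsupp (a := 2 * ((m : ℝ) + x)) (by positivity)
    rw [← hN2, ← hk] at hD
    have hE : Integrable fun u : ℝ ↦ Real.exp (-(2 * ((m : ℝ) + x) * |u|)) :=
      integrable_exp_neg_mul_abs (by positivity)
    have hEk : Integrable fun u : ℝ ↦ Real.exp (-(2 * ((m : ℝ) + x) * |u|)) * (k u).re := by
      refine (hE.mul_const N2).mono' ?_ (Eventually.of_forall fun u ↦ ?_)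
      · exact ((Real.continuous_exp.comp ((continuous_const.mul continuous_abs).neg)).mul
          (Complex.continuous_re.comp (hg.weilConv hg.weilReflect).1.continuous)).aestronglyMeasurable
      · rw [norm_mul, Real.norm_of_nonneg (Real.exp_pos _).le]
        exact mul_le_mul_of_nonneg_left ((Complex.abs_re_le_norm _).trans (norm_weilConv_weilReflect_le hg u))
          (Real.exp_pos _).le
    have hsplit : ∫ u : ℝ, Real.exp (-(2 * ((m : ℝ) + x) * |u|)) * (N2 - (k u).re) =
        (∫ u : ℝ, Real.exp (-(2 * ((m : ℝ) + x) * |u|))) * N2 -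
          ∫ u : ℝ, Real.exp (-(2 * ((m : ℝ) + x) * |u|)) * (k u).re := by
      rw [← integral_mul_const, ← integral_sub (hE.mul_const _) hEk]
      refine integral_congr_ae (Eventually.of_forall fun u ↦ ?_)
      simp only; ring
    rw [integral_exp_neg_mul_abs' (by positivity : 0 < 2 * ((m : ℝ) + x))] at hsplit
    have e : ∫ τ : ℝ, W τ * (1 / ((m : ℝ) + x) - ((m : ℝ) + x) / (((m : ℝ) + x) ^ 2 + (τ / 2) ^ 2)) =
        2 * π * ∫ u : ℝ, Real.exp (-(2 * ((m : ℝ) + x) * |u|)) * (N2 - (k u).re) := by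
      rw [← h1, ← mul_assoc, mul_one_div_cancel (ne_of_gt hπ), one_mul]
    rw [e, hsplit]
    refine mul_le_mul_of_nonneg_left ?_ hπ.le
    have e2 : 2 / (2 * ((m : ℝ) + x)) * (1 - Real.exp (-(2 * ((m : ℝ) + x) * t))) * N2 =
        2 / (2 * ((m : ℝ) + x)) * N2 - Real.exp (-(2 * ((m : ℝ) + x) * t)) / ((m : ℝ) + x) * N2 := by
      field_simp
    rw [e2] at hD
    linarith
  have hsum := Finset.sum_le_sum hlayer
  rw [← Finset.mul_sum, ← Finset.sum_mul] at hsum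
  rw [show 1 / (2 * π) * A = A / (2 * π) by ring, le_div_iff₀ hπ]
  have : 2 * π * N2 * (digamma (x : ℂ)).re +
      2 * π * ((∑ m ∈ Finset.range M, Real.exp (-(2 * ((m : ℝ) + x) * t)) / ((m : ℝ) + x)) * N2) ≤ A :=
    le_trans (by linarith) hint
  nlinarith

/-- **UNIFORM CONDUCTOR FLOOR, CELL CERTIFICATE + `M`-LAYER GAIN.**  For `χ` mod `q ≠ 1` of parity `κ`, `x = ¼ + κ/2`,
`t > 0`, `e^{2t} ≤ N + 1`, `ψ₀ ≤ ψ(x)`, `γ ≤ Σ_{m<M} e^{−2(m+x)t}/(m+x)`, and a `φ`-certificate with constant `ρ`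
(`UniformConductorFloorCellsBudget.lean`): `log π − ψ₀ − γ + ρ ≤ log q ⇒ WeilPositivityOnChar χ t`.
[cite: Weil1952FormulesExplicites, (11) and the «lemme» p. 262; Yoshida1992, §2 (2.1), §6] -/
theorem weilPositivityOnChar_of_phi_budget_layers {q : ℕ} (hq : q ≠ 1) (χ : DirichletCharacter ℂ q) {κ : ℕ}
    (hκ : charParity χ = κ) {t : ℝ} (ht : 0 < t) {N : ℕ} (hN : Real.exp (2 * t) ≤ (N : ℝ) + 1) (M : ℕ)
    {ψ₀ : ℝ} (hψ : ψ₀ ≤ (digamma (((1 / 4 + (κ : ℝ) / 2 : ℝ)) : ℂ)).re)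
    {γ : ℝ} (hγ : γ ≤ ∑ m ∈ Finset.range M,
      Real.exp (-(2 * ((m : ℝ) + (1 / 4 + (κ : ℝ) / 2)) * t)) / ((m : ℝ) + (1 / 4 + (κ : ℝ) / 2)))
    {J : ℕ} (hJ : 0 < J) (φ : ℤ → ℝ) {Φ₀ Φ₁ : ℝ} (hΦ₀ : 0 < Φ₀)
    (hφlo : ∀ i, 0 ≤ i → i < (J : ℤ) → Φ₀ ≤ φ i) (hφhi : ∀ i, φ i ≤ Φ₁)
    (hφout : ∀ i, i < 0 ∨ (J : ℤ) ≤ i → φ i = 0) (s : ℕ → ℕ)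
    (hs : ∀ n ∈ Finset.range (N + 1),
      ((s n : ℤ) : ℝ) * (2 * t / J) ≤ Real.log n ∧ Real.log n ≤ (((s n : ℤ) : ℝ) + 1) * (2 * t / J))
    (wbar : ℕ → ℝ) (hw : ∀ n ∈ Finset.range (N + 1), (Λ n : ℝ) / Real.sqrt n ≤ wbar n) {ρ : ℝ}
    (hcert : ∀ j ∈ Finset.range J,
      ∑ n ∈ Finset.range (N + 1), wbar n *
        (max (φ ((j : ℤ) - s n - 1)) (φ ((j : ℤ) - s n)) + max (φ ((j : ℤ) + s n)) (φ ((j : ℤ) + s n + 1))) ≤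
        ρ * φ (j : ℤ))
    (hB : Real.log π - ψ₀ - γ + ρ ≤ Real.log q) :
    WeilPositivityOnChar χ t := by
  intro g hg hsupp
  set k := weilConv g (weilReflect g) with hk
  set N2 := weilNorm2Sq g with hN2
  set x : ℝ := 1 / 4 + (κ : ℝ) / 2 with hx
  have hx0 : 0 < x := by positivity
  have hN20 : 0 ≤ N2 := integral_nonneg fun _ ↦ by positivity
  set A : ℝ := ∫ τ : ℝ, ‖weilMellin g (1 / 2 + τ * I)‖ ^ 2 *
    (digamma ((x : ℂ) + ((τ / 2 : ℝ) : ℂ) * I)).re with hA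
  set G : ℝ := ∑ m ∈ Finset.range M, Real.exp (-(2 * ((m : ℝ) + x) * t)) / ((m : ℝ) + x) with hG
  have hre : (weilQuadraticChar χ g).re =
      -(weilPrimeTermChar χ k).re + (1 / (2 * π) * A + N2 * (Real.log q - Real.log π)) := by
    rw [weilQuadraticChar_eq_neg_prime_add hq χ hκ hg, Complex.add_re, Complex.neg_re, Complex.ofReal_re]
  have hkc : Continuous k := (hg.weilConv hg.weilReflect).1.continuous
  have hks : tsupport k ⊆ Icc (-(2 * t)) (2 * t) := tsupport_weilConv_weilReflect_subset hg.2 hsupp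
  have hPn : ‖weilPrimeTermChar χ k‖ ≤
      ∑ n ∈ Finset.range (N + 1), (Λ n : ℝ) / Real.sqrt n * (2 * ‖k (Real.log n)‖) := by
    rw [weilPrimeTermChar_eq_sum_of_tsupport_subset χ hkc hN hks]
    refine (norm_sum_le _ _).trans (Finset.sum_le_sum fun n _ ↦ ?_)
    have hΛ : 0 ≤ (Λ n : ℝ) / Real.sqrt n :=
      div_nonneg ArithmeticFunction.vonMangoldt_nonneg (Real.sqrt_nonneg _)
    have hcoef : ‖((Λ n : ℝ) : ℂ) / (Real.sqrt n : ℂ)‖ = (Λ n : ℝ) / Real.sqrt n := by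
      rw [← Complex.ofReal_div, Complex.norm_real, Real.norm_of_nonneg hΛ]
    have hχ : ‖χ (n : ZMod q)‖ ≤ 1 := DirichletCharacter.norm_le_one χ _
    have hneg : ‖k (-Real.log n)‖ = ‖k (Real.log n)‖ := by
      rw [hk, weilConv_weilReflect_neg, Complex.norm_conj]
    rw [norm_mul, hcoef]
    refine mul_le_mul_of_nonneg_left ?_ hΛ
    refine (norm_add_le _ _).trans ?_
    rw [norm_mul, norm_mul, Complex.norm_conj, hneg]
    have hk0 : 0 ≤ ‖k (Real.log n)‖ := norm_nonneg _
    nlinarith [mul_le_mul_of_nonneg_right hχ hk0]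
  have hcertR := sum_two_mul_norm_weilConv_le_of_cert hg ht hsupp hJ φ hΦ₀ hφlo hφhi hφout N s hs
    wbar hw hcert
  have hP : (weilPrimeTermChar χ k).re ≤ ρ * N2 :=
    (Complex.re_le_norm _).trans (hPn.trans hcertR)
  have hArch : ((digamma (x : ℂ)).re + G) * N2 ≤ 1 / (2 * π) * A :=
    arch_lower_bound_layers hg hsupp hx0 M
  have hψN : ψ₀ * N2 ≤ (digamma (x : ℂ)).re * N2 := mul_le_mul_of_nonneg_right hψ hN20
  have hγN : γ * N2 ≤ G * N2 := mul_le_mul_of_nonneg_right hγ hN20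
  have hBN : (Real.log π - ψ₀ - γ + ρ) * N2 ≤ Real.log q * N2 :=
    mul_le_mul_of_nonneg_right hB hN20
  rw [hre]
  nlinarith

end UniformFloor

end Summit.Ventures.WeilGRH

end
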